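import Summits.QuantumFields.BalabanUV.Beta.FP.ResidualModeSymbolBound
import Summits.QuantumFields.BalabanUV.Beta.GAN24.AliasWeightsSum

/-!
# `BalabanUV.Beta.FP.ResidualModeAliasBound` — road «FP» (binder row D1), row H′2-IR ∕ IR-3 «IR-3-ELL-REAL», file 2∕2: THE ALIAS ESTIMATE
# `T(k) ≤ A′(d)·Mid(k)·|d̂^c(k)|⁴` n-FREE, hence **`m_{B,n}(k) ≥ c₀(d) := (4∕π²)^{d+3} ∕ A′(d)` for every `n ≥ 1` and every `k ∈ BZ∖{0}`** —
# the residual-mode symbol of Bałaban's covariant inner slice is n-uniformly elliptic on the real zone (IR3-DESIGN §2, «SUFFICIENT (I4) alias bound»)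

NOT IN PRINT; OUR BOOKKEEPING for the road-FP OWNER's IR-3-ELL (E-FP-5-4∕E-FP-5-5; OFFER «IR-3-ELL-REAL» journal l.22229).  File 1∕2 (`ResidualModeSymbolBound`)
reduced `m_B ≥ c₀` to `transT n k ≤ A′·midSym n k·(Σ‖d1Sym k‖²)²` (`mB_ge`); here: the `a = 0` alias term is controlled by Jordan twice
(`n²·Δ̂(k∕n) ≤ (π²∕4)·Δ̂(k)`: `B4Strip.Sxir_le` + `B4Strip.S1r_ge`), the `a ≠ 0` terms by leaf-17∕road-P1's alias-weight machinery BY NAME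
(`AliasWeights.norm_geomExp_sq_le`: `|gsum x n|² ≤ n²·sinWt n x`; `AliasWeights.sinWt_kfine_le_wMaj`; `AliasWeightsSum.four_le_sq_mul_lapR`: `4 ≤ n²·Δ̂(q_a)` for `a ≠ 0`;
`AliasWeightsSum.sum_prod_wMaj_le`: `Σ_{a≠0} Π_i wMaj ≤ 5^D − 1`), and the `a = 0` floor of `midSym` (`ResidualModeSymbols.norm_prod_gsum_apt_zero_ge`:
`|bw_0| ≥ (2n∕π)^D`).  The alias index `Fin D → Fin n` of `AliasDecimate` IS leaf-17's `Fin D → ZMod n` once `n = m+1` (definitional), and `apt (m+1) a k = kfine (m+1) k a` (rfl).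

## What is proved (`0 sorry`, every `d`, `n ≥ 1`; `k ∈ BZ`, `k ≠ 0` for the final bound)
* §1 [folklore] `lapD_eq_lapR`, `sq_mul_lapD_apt_zero_le` (`n²·lapD (k∕n) ≤ (π²∕4)·lapD k`), `lapD_le` (`≤ 4(d+1)`), `norm_gsum_sq_le_sinWt`, `norm_gsum_sq_le`.
* §2 [our object] (with `n = m+1`) `tterm` (the `a`-th summand of `transT`, [our object] def), `transT_eq_sum_tterm`, `apt_eq_kfine`, `tterm_nonneg`,
  **`tterm_le_of_ne_zero`** (`a ≠ 0`: `tterm ≤ n^{2(d+1)}·(n²·lapD k)·(n²∕4)·Π_i wMaj n (a i)`), **`sum_tterm_ne_zero_le`** (`× (5^{d+1} − 1)` after summing),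
  **`tterm_zero_le`** (`tterm 0 ≤ (π²∕4)·(|bw_0|²∕lapD(k∕n)²)·(lapD k)²`), `floor_le_midSym` (`(n^{d+1})⁻¹·|bw_0|²∕lapD(k∕n)² ≤ midSym`),
  **`floor_ge`** (`(2n∕π)^{2(d+1)}·16n⁴∕π⁴ ≤ (|bw_0|²∕lapD(k∕n)²)·(lapD k)²`), **`transT_le`** (`transT n k ≤ aEll d · midSym n k · (lapD k)²`) with the explicit
  n-FREE constant `aEll d := π²∕4 + (d+1)·(5^{d+1} − 1)·(π⁴∕16)·(π∕2)^{2(d+1)}`.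
* §3 [our object] **`mB_ge_const`**: `(4∕π²)^{d+3} ∕ aEll d ≤ mB n k` for every `n ≥ 1`, `k ∈ BZ∖{0}`; `aEll_pos`.
HONEST FRAMING: an n-uniform lower bound on the cell's own U = 1 symbol; 0 estimates of Bałaban's objects; 0∕4 row-D1 binders; NOT D1, NOT BetaPertH, NOT the continuum limit,
NOT Clay.  The passage symbol ↔ operator (`M_B ≥ c₀` on ℓ² of coarse scalars via coarse translation invariance) and the model identities (I1)–(I5) are IR-3-ID ∕ the owner's assembly.
HONEST DEPENDENCY (verbatim): «continuum YM on T⁴ ⇐ BetaPertH ∧ nine spine estimates (0/9 proved); BetaPertH ⇐ (D1) ∧ (D4) ∧ CAP+tail; G-an2-4 gates asym, D1 and NE2/3/4.»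
ABSOLUTE RULE respected: no cited fact, no `def … : Prop`, nothing of the manuscripts asserted.
Provenance: D1 formalisation swarm leaf prover 02, gen 7 (prover-b2b-balaban-beta-d1-formalise-leaf-02-g7-0), road-FP «IR-3-ELL-REAL» (journal l.22229), 2026-08-20.
-/

noncomputable section

open Complex Set Finset Matrix
open scoped Real BigOperators ComplexConjugate
open Literature.MathematicalPhysics.QuantumFieldTheory.Balaban1983to89
open B4Strip (ofRealVec S1r Sxir S1r_eq S1r_ge Sxir_le)
open B4ContourShift (BZ)
open B5Prop11Fiber (d1Sym norm_d1Sym_sq norm_d1Sym_le_two)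
open Summit.QuantumFields.BalabanUV.Beta.GAN24.FibreSymbols (gsum)
open Summit.QuantumFields.BalabanUV.Beta.GAN24.AliasTiling (apt)
open Summit.QuantumFields.BalabanUV.Beta.GAN24.AliasWeights (sinWt sinWt_pos sinWt_le_one wMaj wMaj_nonneg kfine norm_geomExp_sq_le
  sinWt_kfine_le_wMaj)
open Summit.QuantumFields.BalabanUV.Beta.GAN24.AliasWeightsSum (lapR four_le_sq_mul_lapR sum_prod_wMaj_le)
open Summit.QuantumFields.BalabanUV.Beta.FP.PerfectPropagatorBound (sum_norm_sq_pos d1Sym_ne_zero)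
open Summit.QuantumFields.BalabanUV.Beta.FP.CoarseCovarianceEllipticBound (apt_zero_apply apt_zero_mem_BZ)
open Summit.QuantumFields.BalabanUV.Beta.FP.ResidualModeSymbols (norm_prod_gsum_apt_zero_ge)
open Summit.QuantumFields.BalabanUV.Beta.FP.ResidualModeSymbolBound (bweight lapD midSym transT mB lapD_apt_pos midSym_pos transT_pos mB_ge)

namespace Summit.QuantumFields.BalabanUV.Beta.FP.ResidualModeAliasBound

variable {d : ℕ}

/-! ## §1 Letters -/

/-- [folklore] `lapD q = lapR q` (`‖e^{ix} − 1‖² = 4 sin²(x∕2)`). -/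
theorem lapD_eq_lapR (q : Fin (d + 1) → ℝ) : lapD q = lapR q := by
  unfold lapD lapR
  exact Finset.sum_congr rfl fun ν _ => by rw [norm_d1Sym_sq, S1r_eq]

/-- [folklore] JORDAN TWICE: `n²·lapD (k∕n) ≤ (π²∕4)·lapD k` for `k ∈ BZ`. -/
theorem sq_mul_lapD_apt_zero_le (n : ℕ) [NeZero n] {k : Fin (d + 1) → ℝ} (hk : k ∈ BZ (d + 1)) :
    (n : ℝ) ^ 2 * lapD (apt n (fun _ => (0 : Fin n)) k) ≤ Real.pi ^ 2 / 4 * lapD k := by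
  unfold lapD
  rw [Finset.mul_sum, Finset.mul_sum]
  refine Finset.sum_le_sum fun ν _ => ?_
  have hkν : |k ν| ≤ Real.pi := by
    unfold BZ at hk; rw [Set.mem_Icc] at hk; exact abs_le.mpr ⟨hk.1 ν, hk.2 ν⟩
  rw [norm_d1Sym_sq, norm_d1Sym_sq, apt_zero_apply]
  have h1 : (n : ℝ) ^ 2 * S1r (k ν / n) ≤ k ν ^ 2 := by
    have := Sxir_le n (k ν); unfold Sxir at this; unfold S1r; linarith
  have h2 : 4 * k ν ^ 2 / Real.pi ^ 2 ≤ S1r (k ν) := S1r_ge (k ν) hkν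
  have hπ : 0 < Real.pi ^ 2 := by positivity
  have h3 : k ν ^ 2 ≤ Real.pi ^ 2 / 4 * S1r (k ν) := by
    rw [div_le_iff₀ hπ] at h2; nlinarith
  linarith

/-- [folklore] `lapD k ≤ 4(d+1)`. -/
theorem lapD_le (k : Fin (d + 1) → ℝ) : lapD k ≤ 4 * ((d : ℝ) + 1) := by
  unfold lapD
  calc ∑ ν, ‖d1Sym k ν‖ ^ 2 ≤ ∑ _ν : Fin (d + 1), (4 : ℝ) := Finset.sum_le_sum fun ν _ => by
          have h := norm_d1Sym_le_two k ν
          have h0 := norm_nonneg (d1Sym k ν)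
          nlinarith
    _ = 4 * ((d : ℝ) + 1) := by simp; ring

/-- [folklore] `‖gsum x n‖² ≤ n²·sinWt n x` for real `x` (leaf-17's `norm_geomExp_sq_le`). -/
theorem norm_gsum_sq_le_sinWt (x : ℝ) (n : ℕ) : ‖gsum (x : ℂ) n‖ ^ 2 ≤ (n : ℝ) ^ 2 * sinWt n x := by
  unfold gsum; exact norm_geomExp_sq_le x n

/-- [folklore] `‖gsum x n‖² ≤ n²` for real `x`. -/
theorem norm_gsum_sq_le (x : ℝ) (n : ℕ) : ‖gsum (x : ℂ) n‖ ^ 2 ≤ (n : ℝ) ^ 2 := by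
  have h := norm_gsum_sq_le_sinWt x n
  have h1 := sinWt_le_one n x
  nlinarith [sq_nonneg (n : ℝ)]

/-! ## §2 The alias estimate at `n = m + 1` -/

section Alias

variable (m : ℕ) (k : Fin (d + 1) → ℝ)

/-- [our object] THE `a`-TH SUMMAND OF `transT`: `|bw_a|²·(Σ_μ |gsum((q_a)_μ) n|²·‖dc_μ‖²) ∕ lapD q_a`. -/
def tterm (n : ℕ) (k : Fin (d + 1) → ℝ) (a : Fin (d + 1) → Fin n) : ℝ :=
  ‖bweight n (ofRealVec (apt n a k))‖ ^ 2 * (∑ μ, ‖gsum (ofRealVec (apt n a k) μ) n‖ ^ 2 * ‖d1Sym k μ‖ ^ 2) / lapD (apt n a k)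

/-- [folklore] `transT n k = (n^{d+1})⁻¹ Σ_a tterm n k a`. -/
theorem transT_eq_sum_tterm (n : ℕ) (k : Fin (d + 1) → ℝ) : transT n k = ((n : ℝ) ^ (d + 1))⁻¹ * ∑ a : Fin (d + 1) → Fin n, tterm n k a := rfl

/-- [folklore] `0 ≤ tterm`. -/
theorem tterm_nonneg (n : ℕ) (k : Fin (d + 1) → ℝ) (a : Fin (d + 1) → Fin n) : 0 ≤ tterm n k a := by
  unfold tterm lapD
  exact div_nonneg (mul_nonneg (sq_nonneg _) (Finset.sum_nonneg fun _ _ => by positivity)) (Finset.sum_nonneg fun _ _ => by positivity)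

/-- [folklore] With `n = m+1` the alias index of `AliasDecimate` IS leaf-17's and `apt (m+1) a k = kfine (m+1) k a`. -/
theorem apt_eq_kfine (a : Fin (d + 1) → Fin (m + 1)) : apt (m + 1) a k = kfine (m + 1) k a := by
  funext i; rfl

/-- [folklore] Numerator bound: `|bw_a|²·Σ_μ|g_μ|²‖dc_μ‖² ≤ n^{2(d+1)}·(Π_i sinWt n (q_a i))·(n²·lapD k)`. -/
theorem numerator_le (a : Fin (d + 1) → Fin (m + 1)) :
    ‖bweight (m + 1) (ofRealVec (apt (m + 1) a k))‖ ^ 2 * (∑ μ, ‖gsum (ofRealVec (apt (m + 1) a k) μ) (m + 1)‖ ^ 2 * ‖d1Sym k μ‖ ^ 2)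
      ≤ ((((m + 1 : ℕ) : ℝ) ^ 2) ^ (d + 1) * ∏ i, sinWt (m + 1) (apt (m + 1) a k i)) * ((((m + 1 : ℕ) : ℝ) ^ 2) * lapD k) := by
  refine mul_le_mul ?_ ?_ (Finset.sum_nonneg fun _ _ => by positivity)
    (mul_nonneg (by positivity) (Finset.prod_nonneg fun i _ => (sinWt_pos _ _).le))
  · unfold bweight
    rw [norm_prod, ← Finset.prod_pow]
    calc ∏ i, ‖gsum (ofRealVec (apt (m + 1) a k) i) (m + 1)‖ ^ 2
        ≤ ∏ i, ((((m + 1 : ℕ) : ℝ) ^ 2) * sinWt (m + 1) (apt (m + 1) a k i)) :=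
          Finset.prod_le_prod (fun i _ => by positivity) fun i _ => norm_gsum_sq_le_sinWt (apt (m + 1) a k i) (m + 1)
      _ = ((((m + 1 : ℕ) : ℝ) ^ 2) ^ (d + 1)) * ∏ i, sinWt (m + 1) (apt (m + 1) a k i) := by
          rw [Finset.prod_mul_distrib, Finset.prod_const, Finset.card_univ, Fintype.card_fin]
  · unfold lapD
    rw [Finset.mul_sum]
    exact Finset.sum_le_sum fun μ _ => mul_le_mul_of_nonneg_right (norm_gsum_sq_le (apt (m + 1) a k μ) (m + 1)) (by positivity)

/-- [our object] **THE `a ≠ 0` TERMS**: `tterm ≤ n^{2(d+1)}·(n²·lapD k)·(n²∕4)·Π_i wMaj n (a i)` (`4 ≤ n²·lapD q_a` for `a ≠ 0`). -/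
theorem tterm_le_of_ne_zero {k : Fin (d + 1) → ℝ} (hk : k ∈ BZ (d + 1)) {a : Fin (d + 1) → Fin (m + 1)} (ha : a ≠ fun _ => 0) :
    tterm (m + 1) k a ≤ (((m + 1 : ℕ) : ℝ) ^ 2) ^ (d + 1) * ((((m + 1 : ℕ) : ℝ) ^ 2) * lapD k) * ((((m + 1 : ℕ) : ℝ) ^ 2) / 4)
        * ∏ i, wMaj (m + 1) ((a : Fin (d + 1) → ZMod (m + 1)) i) := by
  have hkabs : ∀ i, |k i| ≤ Real.pi := by
    intro i; unfold BZ at hk; rw [Set.mem_Icc] at hk; exact abs_le.mpr ⟨hk.1 i, hk.2 i⟩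
  have ha0 : (a : Fin (d + 1) → ZMod (m + 1)) ≠ 0 := by
    intro h; exact ha (by funext i; exact congrFun h i)
  -- denominator `4 ≤ n²·lapD q_a`
  have h4 : 4 ≤ (((m + 1 : ℕ) : ℝ)) ^ 2 * lapD (apt (m + 1) a k) := by
    have := four_le_sq_mul_lapR (D := d + 1) (N := m + 1) hkabs ha0
    rw [lapD_eq_lapR, apt_eq_kfine]; exact_mod_cast this
  have hn2 : (0 : ℝ) < (((m + 1 : ℕ) : ℝ)) ^ 2 := by positivity
  have hlap : 0 < lapD (apt (m + 1) a k) := by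
    by_contra h; push Not at h; nlinarith
  -- `Π sinWt ≤ Π wMaj`
  have hprod : ∏ i, sinWt (m + 1) (apt (m + 1) a k i) ≤ ∏ i, wMaj (m + 1) ((a : Fin (d + 1) → ZMod (m + 1)) i) := by
    refine Finset.prod_le_prod (fun i _ => (sinWt_pos _ _).le) fun i _ => ?_
    have := sinWt_kfine_le_wMaj (N := m + 1) hkabs (a : Fin (d + 1) → ZMod (m + 1)) i
    rw [apt_eq_kfine]; exact this
  have hN := numerator_le m k a
  unfold tterm
  rw [div_le_iff₀ hlap]
  -- RHS·lapD ≥ RHS·(4/n²) = n^{2D}(n² lapD k) Π wMaj ≥ numerator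
  have hR : 0 ≤ (((m + 1 : ℕ) : ℝ) ^ 2) ^ (d + 1) * ((((m + 1 : ℕ) : ℝ) ^ 2) * lapD k) := by
    have : 0 ≤ lapD k := Finset.sum_nonneg fun _ _ => by positivity
    positivity
  have hW : 0 ≤ ∏ i, wMaj (m + 1) ((a : Fin (d + 1) → ZMod (m + 1)) i) := Finset.prod_nonneg fun i _ => wMaj_nonneg _ _
  calc ‖bweight (m + 1) (ofRealVec (apt (m + 1) a k))‖ ^ 2 * (∑ μ, ‖gsum (ofRealVec (apt (m + 1) a k) μ) (m + 1)‖ ^ 2 * ‖d1Sym k μ‖ ^ 2)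
      ≤ ((((m + 1 : ℕ) : ℝ) ^ 2) ^ (d + 1) * ∏ i, sinWt (m + 1) (apt (m + 1) a k i)) * ((((m + 1 : ℕ) : ℝ) ^ 2) * lapD k) := hN
    _ ≤ ((((m + 1 : ℕ) : ℝ) ^ 2) ^ (d + 1) * ∏ i, wMaj (m + 1) ((a : Fin (d + 1) → ZMod (m + 1)) i)) * ((((m + 1 : ℕ) : ℝ) ^ 2) * lapD k) := by
        have : 0 ≤ lapD k := Finset.sum_nonneg fun _ _ => by positivity
        exact mul_le_mul_of_nonneg_right (mul_le_mul_of_nonneg_left hprod (by positivity)) (by positivity)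
    _ = ((((m + 1 : ℕ) : ℝ) ^ 2) ^ (d + 1) * ((((m + 1 : ℕ) : ℝ) ^ 2) * lapD k) * ((((m + 1 : ℕ) : ℝ) ^ 2) / 4)
        * ∏ i, wMaj (m + 1) ((a : Fin (d + 1) → ZMod (m + 1)) i)) * (4 / (((m + 1 : ℕ) : ℝ)) ^ 2) := by
        field_simp
    _ ≤ _ := by
        refine mul_le_mul_of_nonneg_left ?_ (mul_nonneg (mul_nonneg hR (by positivity)) hW)
        rw [div_le_iff₀ hn2]; linarith

/-- [our object] **THE `a ≠ 0` ALIAS SUM**: `Σ_{a ≠ 0} tterm ≤ n^{2(d+1)}·(n²·lapD k)·(n²∕4)·(5^{d+1} − 1)`. -/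
theorem sum_tterm_ne_zero_le {k : Fin (d + 1) → ℝ} (hk : k ∈ BZ (d + 1)) :
    ∑ a ∈ (Finset.univ : Finset (Fin (d + 1) → Fin (m + 1))).erase (fun _ => 0), tterm (m + 1) k a
      ≤ (((m + 1 : ℕ) : ℝ) ^ 2) ^ (d + 1) * ((((m + 1 : ℕ) : ℝ) ^ 2) * lapD k) * ((((m + 1 : ℕ) : ℝ) ^ 2) / 4) * ((5 : ℝ) ^ (d + 1) - 1) := by
  set C : ℝ := (((m + 1 : ℕ) : ℝ) ^ 2) ^ (d + 1) * ((((m + 1 : ℕ) : ℝ) ^ 2) * lapD k) * ((((m + 1 : ℕ) : ℝ) ^ 2) / 4) with hC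
  have hC0 : 0 ≤ C := by
    have : 0 ≤ lapD k := Finset.sum_nonneg fun _ _ => by positivity
    positivity
  -- `Fin (m+1) = ZMod (m+1)` definitionally: the two index Finsets coincide
  have hsum : ∑ a ∈ (Finset.univ : Finset (Fin (d + 1) → Fin (m + 1))).erase (fun _ => 0),
      ∏ i, wMaj (m + 1) ((a : Fin (d + 1) → ZMod (m + 1)) i) ≤ (5 : ℝ) ^ (d + 1) - 1 := by
    have h := sum_prod_wMaj_le (D := d + 1) (m + 1)
    exact h
  calc ∑ a ∈ (Finset.univ : Finset (Fin (d + 1) → Fin (m + 1))).erase (fun _ => 0), tterm (m + 1) k a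
      ≤ ∑ a ∈ (Finset.univ : Finset (Fin (d + 1) → Fin (m + 1))).erase (fun _ => 0),
          C * ∏ i, wMaj (m + 1) ((a : Fin (d + 1) → ZMod (m + 1)) i) :=
        Finset.sum_le_sum fun a ha => by rw [hC]; exact tterm_le_of_ne_zero m hk (Finset.mem_erase.1 ha).1
    _ = C * ∑ a ∈ (Finset.univ : Finset (Fin (d + 1) → Fin (m + 1))).erase (fun _ => 0),
          ∏ i, wMaj (m + 1) ((a : Fin (d + 1) → ZMod (m + 1)) i) := by rw [Finset.mul_sum]
    _ ≤ C * ((5 : ℝ) ^ (d + 1) - 1) := mul_le_mul_of_nonneg_left hsum hC0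

/-- [our object] **THE `a = 0` TERM**: `tterm 0 ≤ (π²∕4)·(|bw_0|²∕lapD(k∕n)²)·(lapD k)²` (Jordan twice). -/
theorem tterm_zero_le {k : Fin (d + 1) → ℝ} (hk : k ∈ BZ (d + 1)) (hk0 : k ≠ 0) :
    tterm (m + 1) k (fun _ => 0)
      ≤ Real.pi ^ 2 / 4 * (‖bweight (m + 1) (ofRealVec (apt (m + 1) (fun _ => (0 : Fin (m + 1))) k))‖ ^ 2
          / lapD (apt (m + 1) (fun _ => (0 : Fin (m + 1))) k) ^ 2) * lapD k ^ 2 := by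
  haveI : NeZero (m + 1) := ⟨Nat.succ_ne_zero m⟩
  set q := apt (m + 1) (fun _ => (0 : Fin (m + 1))) k with hq
  set B := ‖bweight (m + 1) (ofRealVec q)‖ ^ 2 with hB
  have hL : 0 < lapD q := lapD_apt_pos (m + 1) hk hk0 _
  have hJ : (((m + 1 : ℕ) : ℝ)) ^ 2 * lapD q ≤ Real.pi ^ 2 / 4 * lapD k := sq_mul_lapD_apt_zero_le (m + 1) hk
  have hN : B * (∑ μ, ‖gsum (ofRealVec q μ) (m + 1)‖ ^ 2 * ‖d1Sym k μ‖ ^ 2) ≤ B * ((((m + 1 : ℕ) : ℝ) ^ 2) * lapD k) := by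
    refine mul_le_mul_of_nonneg_left ?_ (by positivity)
    unfold lapD; rw [Finset.mul_sum]
    exact Finset.sum_le_sum fun μ _ => mul_le_mul_of_nonneg_right (norm_gsum_sq_le (q μ) (m + 1)) (by positivity)
  unfold tterm
  rw [← hq, ← hB, div_le_iff₀ hL]
  calc B * (∑ μ, ‖gsum (ofRealVec q μ) (m + 1)‖ ^ 2 * ‖d1Sym k μ‖ ^ 2) ≤ B * ((((m + 1 : ℕ) : ℝ) ^ 2) * lapD k) := hN
    _ = B * lapD k * ((((m + 1 : ℕ) : ℝ) ^ 2 * lapD q) / lapD q) := by field_simp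
    _ ≤ B * lapD k * ((Real.pi ^ 2 / 4 * lapD k) / lapD q) := by
        have : 0 ≤ lapD k := Finset.sum_nonneg fun _ _ => by positivity
        exact mul_le_mul_of_nonneg_left (div_le_div_of_nonneg_right hJ hL.le) (by positivity)
    _ = Real.pi ^ 2 / 4 * (B / lapD q ^ 2) * lapD k ^ 2 * lapD q := by field_simp

/-- [our object] The `a = 0` term of `midSym` is a floor: `(n^{d+1})⁻¹·|bw_0|²∕lapD(k∕n)² ≤ midSym n k`. -/
theorem floor_le_midSym :
    ((((m + 1 : ℕ) : ℝ)) ^ (d + 1))⁻¹ * (‖bweight (m + 1) (ofRealVec (apt (m + 1) (fun _ => (0 : Fin (m + 1))) k))‖ ^ 2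
        / lapD (apt (m + 1) (fun _ => (0 : Fin (m + 1))) k) ^ 2) ≤ midSym (m + 1) k := by
  unfold midSym
  refine mul_le_mul_of_nonneg_left ?_ (by positivity)
  exact Finset.single_le_sum (f := fun a : Fin (d + 1) → Fin (m + 1) =>
      ‖bweight (m + 1) (ofRealVec (apt (m + 1) a k))‖ ^ 2 / lapD (apt (m + 1) a k) ^ 2)
    (fun a _ => by unfold lapD; positivity) (Finset.mem_univ _)

/-- [our object] **THE FLOOR IS LARGE**: `(2n∕π)^{2(d+1)}·16n⁴∕π⁴ ≤ (|bw_0|²∕lapD(k∕n)²)·(lapD k)²` on the punctured zone. -/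
theorem floor_ge {k : Fin (d + 1) → ℝ} (hk : k ∈ BZ (d + 1)) (hk0 : k ≠ 0) :
    (2 / Real.pi * ((m + 1 : ℕ) : ℝ)) ^ (2 * (d + 1)) * (16 * (((m + 1 : ℕ) : ℝ)) ^ 4 / Real.pi ^ 4)
      ≤ (‖bweight (m + 1) (ofRealVec (apt (m + 1) (fun _ => (0 : Fin (m + 1))) k))‖ ^ 2
          / lapD (apt (m + 1) (fun _ => (0 : Fin (m + 1))) k) ^ 2) * lapD k ^ 2 := by
  haveI : NeZero (m + 1) := ⟨Nat.succ_ne_zero m⟩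
  set q := apt (m + 1) (fun _ => (0 : Fin (m + 1))) k with hq
  have hL : 0 < lapD q := lapD_apt_pos (m + 1) hk hk0 _
  have hs : 0 < lapD k := sum_norm_sq_pos (d1Sym_ne_zero hk hk0)
  have hJ : (((m + 1 : ℕ) : ℝ)) ^ 2 * lapD q ≤ Real.pi ^ 2 / 4 * lapD k := sq_mul_lapD_apt_zero_le (m + 1) hk
  have hbw : (2 / Real.pi * ((m + 1 : ℕ) : ℝ)) ^ (d + 1) ≤ ‖bweight (m + 1) (ofRealVec q)‖ := by
    unfold bweight; exact norm_prod_gsum_apt_zero_ge (m + 1) hk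
  have hbw2 : (2 / Real.pi * ((m + 1 : ℕ) : ℝ)) ^ (2 * (d + 1)) ≤ ‖bweight (m + 1) (ofRealVec q)‖ ^ 2 := by
    rw [pow_mul']; exact pow_le_pow_left₀ (by positivity) hbw 2
  -- `lapD k / lapD q ≥ 4n²/π²`
  have hratio : 4 * (((m + 1 : ℕ) : ℝ)) ^ 2 / Real.pi ^ 2 ≤ lapD k / lapD q := by
    rw [div_le_div_iff₀ (by positivity) hL]
    nlinarith [Real.pi_pos]
  have hratio2 : (4 * (((m + 1 : ℕ) : ℝ)) ^ 2 / Real.pi ^ 2) ^ 2 ≤ (lapD k / lapD q) ^ 2 := pow_le_pow_left₀ (by positivity) hratio 2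
  calc (2 / Real.pi * ((m + 1 : ℕ) : ℝ)) ^ (2 * (d + 1)) * (16 * (((m + 1 : ℕ) : ℝ)) ^ 4 / Real.pi ^ 4)
      = (2 / Real.pi * ((m + 1 : ℕ) : ℝ)) ^ (2 * (d + 1)) * (4 * (((m + 1 : ℕ) : ℝ)) ^ 2 / Real.pi ^ 2) ^ 2 := by ring
    _ ≤ ‖bweight (m + 1) (ofRealVec q)‖ ^ 2 * (lapD k / lapD q) ^ 2 :=
        mul_le_mul hbw2 hratio2 (by positivity) (by positivity)
    _ = ‖bweight (m + 1) (ofRealVec q)‖ ^ 2 / lapD q ^ 2 * lapD k ^ 2 := by field_simp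

/-- [our object] the n-free alias constant `aEll d := π²∕4 + (d+1)·(5^{d+1} − 1)·(π⁴∕16)·(π∕2)^{2(d+1)}` is positive. -/
theorem aEll_pos (d : ℕ) : 0 < Real.pi ^ 2 / 4 + ((d : ℝ) + 1) * ((5 : ℝ) ^ (d + 1) - 1) * (Real.pi ^ 4 / 16) * (Real.pi / 2) ^ (2 * (d + 1)) := by
  have h5 : (1 : ℝ) ≤ (5 : ℝ) ^ (d + 1) := one_le_pow₀ (by norm_num)
  have : 0 ≤ ((d : ℝ) + 1) * ((5 : ℝ) ^ (d + 1) - 1) * (Real.pi ^ 4 / 16) * (Real.pi / 2) ^ (2 * (d + 1)) := by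
    have : 0 ≤ (5 : ℝ) ^ (d + 1) - 1 := by linarith
    positivity
  positivity

/-- [our object] **THE ALIAS ESTIMATE** at `n = m+1`: `transT n k ≤ aEll d · midSym n k · (lapD k)²`. -/
theorem transT_le_succ {k : Fin (d + 1) → ℝ} (hk : k ∈ BZ (d + 1)) (hk0 : k ≠ 0) :
    transT (m + 1) k ≤ (Real.pi ^ 2 / 4 + ((d : ℝ) + 1) * ((5 : ℝ) ^ (d + 1) - 1) * (Real.pi ^ 4 / 16) * (Real.pi / 2) ^ (2 * (d + 1)))
      * midSym (m + 1) k * lapD k ^ 2 := by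
  haveI : NeZero (m + 1) := ⟨Nat.succ_ne_zero m⟩
  set n : ℕ := m + 1 with hn
  set F : ℝ := ‖bweight (m + 1) (ofRealVec (apt (m + 1) (fun _ => (0 : Fin (m + 1))) k))‖ ^ 2
      / lapD (apt (m + 1) (fun _ => (0 : Fin (m + 1))) k) ^ 2 with hF
  have hF0 : 0 ≤ F := by rw [hF]; unfold lapD; positivity
  have hs : 0 < lapD k := sum_norm_sq_pos (d1Sym_ne_zero hk hk0)
  have hs4 : lapD k ≤ 4 * ((d : ℝ) + 1) := lapD_le k
  have hnR : (0 : ℝ) < ((m + 1 : ℕ) : ℝ) := by positivity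
  -- split the alias sum at `a = 0`
  have hsplit : ∑ a : Fin (d + 1) → Fin (m + 1), tterm (m + 1) k a
      = tterm (m + 1) k (fun _ => 0) + ∑ a ∈ (Finset.univ : Finset (Fin (d + 1) → Fin (m + 1))).erase (fun _ => 0), tterm (m + 1) k a := by
    rw [← Finset.add_sum_erase _ _ (Finset.mem_univ (fun _ => (0 : Fin (m + 1))))]
  have h0 := tterm_zero_le m hk hk0
  have h1 := sum_tterm_ne_zero_le m (k := k) hk
  have hfloor := floor_ge m hk hk0
  have hmid := floor_le_midSym m k
  rw [transT_eq_sum_tterm, hsplit]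
  -- the `a ≠ 0` part against the floor: `n^{2D}·n²s·(n²/4)·(5^D−1) ≤ (D(5^D−1)π⁴/16 (π/2)^{2D}) · F s²`
  have hne : (((m + 1 : ℕ) : ℝ) ^ 2) ^ (d + 1) * ((((m + 1 : ℕ) : ℝ) ^ 2) * lapD k) * ((((m + 1 : ℕ) : ℝ) ^ 2) / 4) * ((5 : ℝ) ^ (d + 1) - 1)
      ≤ ((d : ℝ) + 1) * ((5 : ℝ) ^ (d + 1) - 1) * (Real.pi ^ 4 / 16) * (Real.pi / 2) ^ (2 * (d + 1)) * (F * lapD k ^ 2) := by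
    have h5 : 0 ≤ (5 : ℝ) ^ (d + 1) - 1 := by have := one_le_pow₀ (n := d + 1) (by norm_num : (1 : ℝ) ≤ 5); linarith
    -- F s² ≥ (2n/π)^{2D}·16n⁴/π⁴
    have hkey : (((m + 1 : ℕ) : ℝ) ^ 2) ^ (d + 1) * (((m + 1 : ℕ) : ℝ) ^ 2) * (((m + 1 : ℕ) : ℝ) ^ 2)
        = ((Real.pi ^ 4 / 16) * (Real.pi / 2) ^ (2 * (d + 1))) * ((2 / Real.pi * ((m + 1 : ℕ) : ℝ)) ^ (2 * (d + 1)) * (16 * (((m + 1 : ℕ) : ℝ)) ^ 4 / Real.pi ^ 4)) := by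
      have hπ : Real.pi ≠ 0 := Real.pi_pos.ne'
      have hone : (Real.pi / 2) ^ (2 * (d + 1)) * (2 / Real.pi) ^ (2 * (d + 1)) = 1 := by
        rw [← mul_pow, show Real.pi / 2 * (2 / Real.pi) = 1 by field_simp, one_pow]
      have hpi4 : Real.pi ^ 4 / 16 * (16 / Real.pi ^ 4) = 1 := by field_simp
      have hsq : (((m + 1 : ℕ) : ℝ) ^ 2) ^ (d + 1) = (((m + 1 : ℕ) : ℝ)) ^ (2 * (d + 1)) := by rw [← pow_mul]
      rw [hsq, mul_pow (2 / Real.pi)]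
      calc (((m + 1 : ℕ) : ℝ)) ^ (2 * (d + 1)) * (((m + 1 : ℕ) : ℝ) ^ 2) * (((m + 1 : ℕ) : ℝ) ^ 2)
          = (((m + 1 : ℕ) : ℝ)) ^ (2 * (d + 1)) * (((m + 1 : ℕ) : ℝ)) ^ 4 * 1 * 1 := by ring
        _ = (((m + 1 : ℕ) : ℝ)) ^ (2 * (d + 1)) * (((m + 1 : ℕ) : ℝ)) ^ 4
              * ((Real.pi / 2) ^ (2 * (d + 1)) * (2 / Real.pi) ^ (2 * (d + 1))) * (Real.pi ^ 4 / 16 * (16 / Real.pi ^ 4)) := by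
            rw [hone, hpi4]
        _ = _ := by ring
    calc (((m + 1 : ℕ) : ℝ) ^ 2) ^ (d + 1) * ((((m + 1 : ℕ) : ℝ) ^ 2) * lapD k) * ((((m + 1 : ℕ) : ℝ) ^ 2) / 4) * ((5 : ℝ) ^ (d + 1) - 1)
        = ((((m + 1 : ℕ) : ℝ) ^ 2) ^ (d + 1) * (((m + 1 : ℕ) : ℝ) ^ 2) * (((m + 1 : ℕ) : ℝ) ^ 2)) * (lapD k / 4 * ((5 : ℝ) ^ (d + 1) - 1)) := by ring
      _ ≤ ((((m + 1 : ℕ) : ℝ) ^ 2) ^ (d + 1) * (((m + 1 : ℕ) : ℝ) ^ 2) * (((m + 1 : ℕ) : ℝ) ^ 2)) * (((d : ℝ) + 1) * ((5 : ℝ) ^ (d + 1) - 1)) := by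
          refine mul_le_mul_of_nonneg_left ?_ (by positivity)
          exact mul_le_mul_of_nonneg_right (by linarith) h5
      _ = ((Real.pi ^ 4 / 16) * (Real.pi / 2) ^ (2 * (d + 1))) * ((2 / Real.pi * ((m + 1 : ℕ) : ℝ)) ^ (2 * (d + 1)) * (16 * (((m + 1 : ℕ) : ℝ)) ^ 4 / Real.pi ^ 4))
            * (((d : ℝ) + 1) * ((5 : ℝ) ^ (d + 1) - 1)) := by rw [hkey]
      _ ≤ ((Real.pi ^ 4 / 16) * (Real.pi / 2) ^ (2 * (d + 1))) * (F * lapD k ^ 2) * (((d : ℝ) + 1) * ((5 : ℝ) ^ (d + 1) - 1)) := by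
          refine mul_le_mul_of_nonneg_right (mul_le_mul_of_nonneg_left hfloor (by positivity)) (by positivity)
      _ = _ := by ring
  -- assemble
  have hsum : tterm (m + 1) k (fun _ => 0) + ∑ a ∈ (Finset.univ : Finset (Fin (d + 1) → Fin (m + 1))).erase (fun _ => 0), tterm (m + 1) k a
      ≤ (Real.pi ^ 2 / 4 + ((d : ℝ) + 1) * ((5 : ℝ) ^ (d + 1) - 1) * (Real.pi ^ 4 / 16) * (Real.pi / 2) ^ (2 * (d + 1))) * (F * lapD k ^ 2) := by
    have := add_le_add h0 (h1.trans hne)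
    rw [← hF] at this
    linarith
  have hc0 : 0 ≤ ((((m + 1 : ℕ) : ℝ)) ^ (d + 1))⁻¹ := by positivity
  calc ((((m + 1 : ℕ) : ℝ)) ^ (d + 1))⁻¹ * (tterm (m + 1) k (fun _ => 0)
          + ∑ a ∈ (Finset.univ : Finset (Fin (d + 1) → Fin (m + 1))).erase (fun _ => 0), tterm (m + 1) k a)
      ≤ ((((m + 1 : ℕ) : ℝ)) ^ (d + 1))⁻¹ *
          ((Real.pi ^ 2 / 4 + ((d : ℝ) + 1) * ((5 : ℝ) ^ (d + 1) - 1) * (Real.pi ^ 4 / 16) * (Real.pi / 2) ^ (2 * (d + 1))) * (F * lapD k ^ 2)) :=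
        mul_le_mul_of_nonneg_left hsum hc0
    _ = (Real.pi ^ 2 / 4 + ((d : ℝ) + 1) * ((5 : ℝ) ^ (d + 1) - 1) * (Real.pi ^ 4 / 16) * (Real.pi / 2) ^ (2 * (d + 1)))
          * (((((m + 1 : ℕ) : ℝ)) ^ (d + 1))⁻¹ * F) * lapD k ^ 2 := by ring
    _ ≤ _ := by
        refine mul_le_mul_of_nonneg_right (mul_le_mul_of_nonneg_left hmid (aEll_pos d).le) (by positivity)

end Alias

/-! ## §3 IR-3-ELL on the real zone -/

/-- [our object] THE ALIAS ESTIMATE for every `n ≥ 1`: `transT n k ≤ aEll d · midSym n k · (Σ‖d1Sym k‖²)²`. -/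
theorem transT_le (n : ℕ) [NeZero n] {k : Fin (d + 1) → ℝ} (hk : k ∈ BZ (d + 1)) (hk0 : k ≠ 0) :
    transT n k ≤ (Real.pi ^ 2 / 4 + ((d : ℝ) + 1) * ((5 : ℝ) ^ (d + 1) - 1) * (Real.pi ^ 4 / 16) * (Real.pi / 2) ^ (2 * (d + 1)))
      * midSym n k * (∑ μ, ‖d1Sym k μ‖ ^ 2) ^ 2 := by
  obtain ⟨m, rfl⟩ := Nat.exists_eq_succ_of_ne_zero (NeZero.ne n)
  exact transT_le_succ m hk hk0

/-- [our object] **IR-3-ELL ON THE REAL ZONE, n-FREE**: for every `d`, every `n ≥ 1` and every `k ∈ [−π,π]^{d+1} ∖ {0}`,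
`(4∕π²)^{d+3} ∕ aEll d ≤ m_{B,n}(k)`, `aEll d = π²∕4 + (d+1)(5^{d+1} − 1)(π⁴∕16)(π∕2)^{2(d+1)}`. -/
theorem mB_ge_const (n : ℕ) [NeZero n] {k : Fin (d + 1) → ℝ} (hk : k ∈ BZ (d + 1)) (hk0 : k ≠ 0) :
    (4 / Real.pi ^ 2) ^ (d + 1 + 2) / (Real.pi ^ 2 / 4 + ((d : ℝ) + 1) * ((5 : ℝ) ^ (d + 1) - 1) * (Real.pi ^ 4 / 16) * (Real.pi / 2) ^ (2 * (d + 1)))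
      ≤ mB n k := by
  set A : ℝ := Real.pi ^ 2 / 4 + ((d : ℝ) + 1) * ((5 : ℝ) ^ (d + 1) - 1) * (Real.pi ^ 4 / 16) * (Real.pi / 2) ^ (2 * (d + 1)) with hA
  have hApos : 0 < A := aEll_pos d
  have hT := transT_le n hk hk0
  have hTpos := transT_pos n hk hk0
  have hm := midSym_pos n hk hk0
  have hs : 0 < ∑ μ, ‖d1Sym k μ‖ ^ 2 := sum_norm_sq_pos (d1Sym_ne_zero hk hk0)
  have h := mB_ge n hk hk0
  refine le_trans ?_ h
  -- `γ/A ≤ γ·(mid s²)/T` since `T ≤ A·mid·s²`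
  rw [div_le_div_iff₀ hApos hTpos]
  have hγ : (0 : ℝ) ≤ (4 / Real.pi ^ 2) ^ (d + 1 + 2) := by positivity
  calc (4 / Real.pi ^ 2) ^ (d + 1 + 2) * transT n k ≤ (4 / Real.pi ^ 2) ^ (d + 1 + 2) * (A * midSym n k * (∑ μ, ‖d1Sym k μ‖ ^ 2) ^ 2) :=
        mul_le_mul_of_nonneg_left hT hγ
    _ = (4 / Real.pi ^ 2) ^ (d + 1 + 2) * (midSym n k * (∑ μ, ‖d1Sym k μ‖ ^ 2) ^ 2) * A := by ring

/-- [our object] **PACKAGED for consumers**: one n-FREE positive constant below `m_{B,n}` on the whole punctured zone, every `n ≥ 1` (every `d`). -/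
theorem exists_pos_le_mB (d : ℕ) : ∃ c₀ : ℝ, 0 < c₀ ∧ ∀ (n : ℕ) [NeZero n] (k : Fin (d + 1) → ℝ), k ∈ BZ (d + 1) → k ≠ 0 → c₀ ≤ mB n k :=
  ⟨_, div_pos (by positivity) (aEll_pos d), fun n _ _ hk hk0 => mB_ge_const n hk hk0⟩

end Summit.QuantumFields.BalabanUV.Beta.FP.ResidualModeAliasBound

end
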